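import Mathlib.RingTheory.Ideal.Quotient.Operations
import Mathlib.RingTheory.Localization.AsSubring
import Literature.AlgebraicGeometry.Resolution.RankOneReductionProofs
import Summits.ResolutionOfSingularities.ResolutionOfSingularities.Theorems.ValuativeRankOneReductionResidue
import HarnessLib

/-!
# Rank-one reduction, absolute form: re-modelling a regular local ring (helper for `RankOneReduction`)

Support file for item `stmt-ResolutionOfSingularities-0563`
(`Theses.Valuative.RankOneReduction`, the ABSOLUTE rank-one reduction of local uniformization:
absolute LU for rank-one valuation rings ⇒ absolute LU for all valuation rings).

The key step making the ABSOLUTE reduction formal (`exists_remodel`). Let `ν = ν₁ ∘ ν₂` on `K/k`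
(`O ≤ O₁`), and let `A₀ ⊆ O₁` be an affine model with `L := (A₀)` localised at the centre of
`ν₁` regular (absolute local uniformization of `ν₁`). Absolute local uniformization of the
restriction of `ν₂` to `κ := Frac Φ(A₀) ⊆ κ(O₁)` (`Φ` the residue map) gives SOME finitely
generated `B ⊆ κ` inside the valuation ring of `ν₂|κ`, `Frac B = κ`, regular at the centre of
`ν₂` — but not one above `Φ(A₀)`, which Novacoski–Spivakovsky's relative Cor. 2.17 would need.
Instead we RE-MODEL `L`: lifting generators `b̄` of `B` to fractions `a/s` (`a, s ∈ A₀`,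
`ν₁(s) = 0`) and replacing each generator `x` of `A₀` by the three elements `n, d, x d - n`
(`n, d` lifts of a numerator and denominator of `Φ(x)` in `B`), one obtains a finitely generated
`A ⊆ O` with the SAME local ring at the centre of `ν₁` (so regular) and with residue ring
`Φ(A) = B` exactly, whence `A_Q / P A_Q ≅ B_{centre}` is regular
(`isRegularLocalRing_quotCentre_of_residues_eq`). These are precisely the two inputs of the
final blowing-up step `Literature.AlgebraicGeometry.Resolution.novacoskiSpivakovsky2014_step`.

Source for the surrounding argument: J. Novacoski, M. Spivakovsky, *Reduction of local
uniformization to the rank one case*, arXiv:1204.4751, §2–§3 (Lemma 2.5, Lemma 2.15). The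
re-modelling device itself is new here (it is what removes "relative" from Thm. 1.1 in the
function-field setting).
-/

set_option linter.dupNamespace false  -- Summit.<S>.<S>.Theorems is the D-0017 layout (single-conjunct summit)

noncomputable section

open IsLocalRing
open Literature.AlgebraicGeometry.Resolution

namespace Summit.ResolutionOfSingularities.ResolutionOfSingularities.Theorems

variable {k K : Type} [Field k] [Field K] [Algebra k K]

set_option maxHeartbeats 800000 in
-- one long construction with many local definitions; splitting it would duplicate the set-up
/-- **Re-modelling.** For `ν = ν₁ ∘ ν₂` on `K/k` (`k ⊆ O ≤ O₁`) and an affine model `A₀ ⊆ O₁` of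
`K` whose localisation at the centre of `ν₁` is regular: if the restriction of `ν₂` to every
field `κ → κ(O₁)` over `k` having an affine model admits ABSOLUTE local uniformization (some
finitely generated `B` in its valuation ring with `Frac B = κ`, regular at the centre), then
there is a finitely generated `A ⊆ O` with `Frac A = K`, `A` localised at the centre `P` of `ν₁`
regular, and (`A` localised at the centre `Q` of `ν`) `⧸ P` regular. [folklore] -/
theorem exists_remodel (O O₁ : ValuationSubring K) (hO : O ≤ O₁)
    (hk : ∀ c : k, algebraMap k K c ∈ O)
    (A₀ : Subalgebra k K) (hA₀ : A₀.toSubring ≤ O₁.toSubring) (hA₀fg : A₀.FG)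
    (hfrac₀ : IsFractionRing A₀ K)
    (hreg₀ : IsRegularLocalRing
      (Localization.AtPrime ((maximalIdeal O₁).comap (Subring.inclusion hA₀))))
    (h₂ : ∀ (κ : Type) [Field κ] [Algebra k κ] (ι : κ →+* ResidueField O₁),
      (∀ c : k, algebraMap k κ c ∈ (residueValuationSubring O O₁ hO).comap ι) →
      (∃ R : Subalgebra k κ, R.FG ∧ IsFractionRing R κ) →
      ∃ (B : Subalgebra k κ)
        (hB : B.toSubring ≤ ((residueValuationSubring O O₁ hO).comap ι).toSubring),
        B.FG ∧ IsFractionRing B κ ∧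
        IsRegularLocalRing (Localization.AtPrime
          ((maximalIdeal ((residueValuationSubring O O₁ hO).comap ι)).comap
            (Subring.inclusion hB)))) :
    ∃ (A : Subalgebra k K) (hA : A.toSubring ≤ O.toSubring), A.FG ∧ IsFractionRing A K ∧
      IsRegularLocalRing
        (Localization.AtPrime ((maximalIdeal O₁).comap (Subring.inclusion (hA.trans hO)))) ∧
      IsRegularLocalRing
        (Localization.AtPrime ((maximalIdeal O).comap (Subring.inclusion hA)) ⧸
          ((maximalIdeal O₁).comap (Subring.inclusion (hA.trans hO))).map
            (algebraMap A.toSubring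
              (Localization.AtPrime ((maximalIdeal O).comap (Subring.inclusion hA))))) := by
  classical
  haveI : IsFractionRing A₀.toSubring K := hfrac₀
  set O₂ := residueValuationSubring O O₁ hO with hO₂def
  set P₀ := ((maximalIdeal O₁).comap (Subring.inclusion hA₀)) with hP₀def
  let φ : A₀.toSubring →+* ResidueField O₁ := ((residue O₁).comp (Subring.inclusion hA₀))
  -- the residue field `κ = Frac (A₀ / P₀)` inside `κ(O₁)`, with its `k`-structure
  let κ : Subfield (ResidueField O₁) := Subfield.closure (Set.range φ)
  have hφκ : ∀ a, φ a ∈ κ := fun a => Subfield.subset_closure ⟨a, rfl⟩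
  let φκ : A₀ →+* κ := (φ.codRestrict κ.toSubring hφκ : A₀.toSubring →+* κ)
  letI : Algebra k κ := (φκ.comp (algebraMap k A₀)).toAlgebra
  let φₐ : A₀ →ₐ[k] κ := { φκ with commutes' := fun c => rfl }
  let ι : κ →+* ResidueField O₁ := κ.subtype
  have hφunit : ∀ s : A₀, s ∉ P₀ → O₁.valuation (s : K) = 1 := fun s hs =>
    (mem_primeCompl_centre_iff O₁ A₀ hA₀ s).mp hs
  -- the model `B₀ = φ(A₀)` of `κ`
  let B₀ : Subalgebra k κ := φₐ.range
  have hmemB₀ : ∀ x : κ, x ∈ B₀ ↔ ∃ a : A₀, φκ a = x := fun x => AlgHom.mem_range φₐ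
  have hrange : (Subring.closure (Set.range φ)) = φ.range := by
    rw [← RingHom.coe_range, Subring.closure_eq]
  have hB₀frac : IsFractionRing B₀ κ := by
    apply IsFractionRing.of_field
    rintro ⟨z, hz⟩
    rw [Subfield.mem_closure_iff] at hz
    obtain ⟨y, hy, w, hw, rfl⟩ := hz
    rw [hrange] at hy hw
    obtain ⟨a, rfl⟩ := hy
    obtain ⟨b, rfl⟩ := hw
    refine ⟨⟨φκ a, (hmemB₀ _).mpr ⟨a, rfl⟩⟩, ⟨φκ b, (hmemB₀ _).mpr ⟨b, rfl⟩⟩, ?_⟩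
    apply Subtype.ext
    rfl
  have hB₀fg : B₀.FG := by
    have h := ((Subalgebra.fg_top A₀).mpr hA₀fg).map φₐ
    rwa [Algebra.map_top] at h
  have hkW : ∀ c : k, algebraMap k κ c ∈ O₂.comap ι := by
    intro c
    change residue O₁ ⟨algebraMap k K c, hO (hk c)⟩ ∈ O₂
    exact (residue_mem_residueValuationSubring_iff O O₁ hO _).mpr (hk c)
  -- absolute local uniformization of `ν₂|κ`: the regular model `B`
  obtain ⟨B, hB, hBfg, hBfrac, hregB⟩ := h₂ κ ι hkW ⟨B₀, hB₀fg, hB₀frac⟩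
  obtain ⟨tB, htB⟩ := id hBfg
  haveI : IsFractionRing B.toSubring κ := hBfrac
  have htBB : ∀ b ∈ tB, b ∈ B := fun b hb => by rw [← htB]; exact Algebra.subset_adjoin hb
  -- lifting elements of `κ` to fractions `a / s` over `A₀` with `s ∉ P₀`
  have hlift : ∀ b : κ, ∃ a s : A₀, s ∉ P₀ ∧ (b : ResidueField O₁) = φ a / φ s := by
    rintro ⟨z, hz⟩
    rw [Subfield.mem_closure_iff] at hz
    obtain ⟨y, hy, w, hw, rfl⟩ := hz
    rw [hrange] at hy hw
    obtain ⟨a, rfl⟩ := hy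
    obtain ⟨s, rfl⟩ := hw
    by_cases hs : s ∈ P₀
    · refine ⟨0, 1, ?_, ?_⟩
      · exact ((maximalIdeal O₁).comap (Subring.inclusion hA₀)).primeCompl.one_mem
      · have : φ s = 0 := (residue_inclusion_eq_zero_iff O₁ A₀ hA₀ s).mpr hs
        simp [this]
    · exact ⟨a, s, hs, rfl⟩
  choose fa fs hfs hlift using hlift
  let g : κ → K := fun b => (fa b : K) / (fs b : K)
  have hgO₁ : ∀ b, g b ∈ O₁ := fun b => by
    simp only [g, div_eq_mul_inv]
    exact mul_mem (hA₀ (fa b).2) (inv_mem_of_valuation_eq_one O₁ (hφunit _ (hfs b)))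
  have hgres : ∀ b, residue O₁ ⟨g b, hgO₁ b⟩ = (b : ResidueField O₁) := fun b => by
    rw [hlift b]
    exact residue_div O₁ _ _ (hA₀ (fa b).2) (hA₀ (fs b).2) (hφunit _ (hfs b)) _
  have hgO : ∀ b : κ, b ∈ B → g b ∈ O := fun b hb => by
    rw [← residue_mem_residueValuationSubring_iff O O₁ hO ⟨g b, hgO₁ b⟩, hgres b]
    exact hB hb
  have hgne : ∀ b : κ, b ≠ 0 → g b ≠ 0 := fun b hb h0 => by
    apply hb
    have h := hgres b
    have h' : (⟨g b, hgO₁ b⟩ : O₁) = 0 := Subtype.ext h0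
    rw [h', map_zero] at h
    exact Subtype.ext h.symm
  have hgval : ∀ b : κ, b ≠ 0 → O₁.valuation (g b) = 1 := fun b hb => by
    have hu : IsUnit (⟨g b, hgO₁ b⟩ : O₁) := by
      rw [← residue_ne_zero_iff_isUnit, hgres b]
      exact fun h => hb (Subtype.ext h)
    exact (O₁.valuation_eq_one_iff _).mp hu
  have hgL : ∀ b, g b ∈ (Localization.subalgebra.ofField K
      ((maximalIdeal O₁).comap (Subring.inclusion hA₀)).primeCompl
      (Ideal.primeCompl_le_nonZeroDivisors _)) := fun b => by
    rw [mem_centreLocalization_iff]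
    exact ⟨fa b, (fa b).2, fs b, (fs b).2, hφunit _ (hfs b), div_eq_mul_inv _ _⟩
  -- numerators and denominators in `B` of the residues of the elements of `A₀`
  have hnd : ∀ x : A₀, ∃ nd : κ × κ, nd.1 ∈ B ∧ nd.2 ∈ B ∧ nd.2 ≠ 0 ∧ φκ x * nd.2 = nd.1 := by
    intro x
    obtain ⟨n, d, hd, hnd⟩ := IsFractionRing.div_surjective (A := B) (φκ x)
    have hd0 : (d : κ) ≠ 0 := fun h => nonZeroDivisors.ne_zero hd (Subtype.ext h)
    refine ⟨((n : κ), (d : κ)), n.2, d.2, hd0, ?_⟩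
    rw [← hnd]
    exact div_mul_cancel₀ (n : κ) hd0
  choose nd hnd1 hnd2 hnd0 hndeq using hnd
  -- the modified generators: `N x`, `D x` lift a numerator / denominator of `φ x`, `H x = x D - N`
  let N : K → K := fun x => if hx : x ∈ A₀ then g (nd ⟨x, hx⟩).1 else 0
  let D : K → K := fun x => if hx : x ∈ A₀ then g (nd ⟨x, hx⟩).2 else 1
  let H : K → K := fun x => x * D x - N x
  have hN : ∀ (x : K) (hx : x ∈ A₀), N x = g (nd ⟨x, hx⟩).1 := fun x hx => dif_pos hx
  have hD : ∀ (x : K) (hx : x ∈ A₀), D x = g (nd ⟨x, hx⟩).2 := fun x hx => dif_pos hx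
  have hNO : ∀ x, N x ∈ O := fun x => by
    by_cases hx : x ∈ A₀
    · rw [hN x hx]; exact hgO _ (hnd1 ⟨x, hx⟩)
    · simp only [N, hx, dif_neg, not_false_eq_true]; exact O.zero_mem
  have hDO : ∀ x, D x ∈ O := fun x => by
    by_cases hx : x ∈ A₀
    · rw [hD x hx]; exact hgO _ (hnd2 ⟨x, hx⟩)
    · simp only [D, hx, dif_neg, not_false_eq_true]; exact O.one_mem
  have hNL : ∀ x, N x ∈ (Localization.subalgebra.ofField K
      ((maximalIdeal O₁).comap (Subring.inclusion hA₀)).primeCompl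
      (Ideal.primeCompl_le_nonZeroDivisors _)) := fun x => by
    by_cases hx : x ∈ A₀
    · rw [hN x hx]; exact hgL _
    · simp only [N, hx, dif_neg, not_false_eq_true]; exact Subalgebra.zero_mem _
  have hDL : ∀ x, D x ∈ (Localization.subalgebra.ofField K
      ((maximalIdeal O₁).comap (Subring.inclusion hA₀)).primeCompl
      (Ideal.primeCompl_le_nonZeroDivisors _)) := fun x => by
    by_cases hx : x ∈ A₀
    · rw [hD x hx]; exact hgL _
    · simp only [D, hx, dif_neg, not_false_eq_true]; exact Subalgebra.one_mem _
  have hDval : ∀ x ∈ A₀, O₁.valuation (D x) = 1 := fun x hx => by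
    rw [hD x hx]; exact hgval _ (hnd0 ⟨x, hx⟩)
  have hDne : ∀ x ∈ A₀, D x ≠ 0 := fun x hx => by
    rw [hD x hx]; exact hgne _ (hnd0 ⟨x, hx⟩)
  have hHO₁ : ∀ x ∈ A₀, H x ∈ O₁ := fun x hx =>
    sub_mem (mul_mem (hA₀ hx) (hO (hDO x))) (hO (hNO x))
  have hNres : ∀ (x : K) (hx : x ∈ A₀),
      residue O₁ ⟨N x, hO (hNO x)⟩ = (((nd ⟨x, hx⟩).1 : κ) : ResidueField O₁) := fun x hx => by
    have e : (⟨N x, hO (hNO x)⟩ : O₁) = ⟨g (nd ⟨x, hx⟩).1, hgO₁ _⟩ := Subtype.ext (hN x hx)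
    rw [e, hgres]
  have hDres : ∀ (x : K) (hx : x ∈ A₀),
      residue O₁ ⟨D x, hO (hDO x)⟩ = (((nd ⟨x, hx⟩).2 : κ) : ResidueField O₁) := fun x hx => by
    have e : (⟨D x, hO (hDO x)⟩ : O₁) = ⟨g (nd ⟨x, hx⟩).2, hgO₁ _⟩ := Subtype.ext (hD x hx)
    rw [e, hgres]
  have hHres : ∀ (x : K) (hx : x ∈ A₀), residue O₁ ⟨H x, hHO₁ x hx⟩ = 0 := fun x hx => by
    have e : (⟨H x, hHO₁ x hx⟩ : O₁) =
        ⟨x, hA₀ hx⟩ * ⟨D x, hO (hDO x)⟩ - ⟨N x, hO (hNO x)⟩ := rfl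
    have hx' : residue O₁ ⟨x, hA₀ hx⟩ = ((φκ ⟨x, hx⟩ : κ) : ResidueField O₁) := rfl
    rw [e, map_sub, map_mul, hx', hDres x hx, hNres x hx, ← MulMemClass.coe_mul, hndeq, sub_self]
  have hHO : ∀ x ∈ A₀, H x ∈ O := fun x hx =>
    mem_of_mem_maximalIdeal_of_le O O₁ hO ⟨H x, hHO₁ x hx⟩
      ((residue_eq_zero_iff _).mp (hHres x hx))
  -- the new model `A`
  obtain ⟨t₀, ht₀⟩ := id hA₀fg
  have ht₀A₀ : ∀ x ∈ t₀, x ∈ A₀ := fun x hx => by rw [← ht₀]; exact Algebra.subset_adjoin hx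
  let gens : Finset K := tB.image g ∪ (t₀.image N ∪ (t₀.image D ∪ t₀.image H))
  let A : Subalgebra k K := Algebra.adjoin k (gens : Set K)
  have hgens : ∀ y ∈ gens, (∃ b ∈ tB, g b = y) ∨ (∃ x ∈ t₀, N x = y) ∨
      (∃ x ∈ t₀, D x = y) ∨ (∃ x ∈ t₀, H x = y) := by
    intro y hy
    simpa only [gens, Finset.mem_union, Finset.mem_image] using hy
  have hadj : ∀ T : Subalgebra k K, (∀ b ∈ tB, g b ∈ T) → (∀ x ∈ t₀, N x ∈ T) →
      (∀ x ∈ t₀, D x ∈ T) → (∀ x ∈ t₀, H x ∈ T) → A ≤ T := by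
    intro T h1 h2 h3 h4
    refine Algebra.adjoin_le fun y hy => ?_
    rcases hgens y (Finset.mem_coe.mp hy) with ⟨b, hb, rfl⟩ | ⟨x, hx, rfl⟩ | ⟨x, hx, rfl⟩ |
      ⟨x, hx, rfl⟩
    exacts [h1 b hb, h2 x hx, h3 x hx, h4 x hx]
  have hgenA : ∀ y ∈ gens, y ∈ A := fun y hy => Algebra.subset_adjoin (Finset.mem_coe.mpr hy)
  have hgA : ∀ b ∈ tB, g b ∈ A := fun b hb => hgenA _ (by
    simp only [gens, Finset.mem_union, Finset.mem_image]; exact Or.inl ⟨b, hb, rfl⟩)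
  have hNA : ∀ x ∈ t₀, N x ∈ A := fun x hx => hgenA _ (by
    simp only [gens, Finset.mem_union, Finset.mem_image]; exact Or.inr (Or.inl ⟨x, hx, rfl⟩))
  have hDA : ∀ x ∈ t₀, D x ∈ A := fun x hx => hgenA _ (by
    simp only [gens, Finset.mem_union, Finset.mem_image]
    exact Or.inr (Or.inr (Or.inl ⟨x, hx, rfl⟩)))
  have hHA : ∀ x ∈ t₀, H x ∈ A := fun x hx => hgenA _ (by
    simp only [gens, Finset.mem_union, Finset.mem_image]
    exact Or.inr (Or.inr (Or.inr ⟨x, hx, rfl⟩)))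
  have hAfg : A.FG := ⟨gens, rfl⟩
  -- (a) `A ⊆ O`
  let Ok : Subalgebra k K := { O.toSubring with algebraMap_mem' := hk }
  have hAOk : A ≤ Ok := hadj Ok (fun b hb => hgO b (htBB b hb)) (fun x _ => hNO x)
    (fun x _ => hDO x) (fun x hx => hHO x (ht₀A₀ x hx))
  have hAO : A.toSubring ≤ O.toSubring := fun x hx => hAOk hx
  have hAO₁ : A.toSubring ≤ O₁.toSubring := hAO.trans hO
  -- (b) `Frac A = K`: the subfield generated by `A` contains the generators of `A₀`
  let F : Subfield K := Subfield.closure (A : Set K)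
  have hAF : (A : Set K) ⊆ F := Subfield.subset_closure
  have ht₀F : ∀ x ∈ t₀, x ∈ F := fun x hx => by
    have hx' := ht₀A₀ x hx
    have key : (H x + N x) / D x = x := by
      simp only [H]
      rw [sub_add_cancel, mul_div_cancel_right₀ _ (hDne x hx')]
    rw [← key]
    exact F.div_mem (F.add_mem (hAF (hHA x hx)) (hAF (hNA x hx))) (hAF (hDA x hx))
  let F' : Subalgebra k K :=
    { F.toSubring with algebraMap_mem' := fun c => hAF (A.algebraMap_mem c) }
  have hA₀F : A₀ ≤ F' := by
    have h : Algebra.adjoin k (t₀ : Set K) ≤ F' :=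
      Algebra.adjoin_le fun x hx => ht₀F x (Finset.mem_coe.mp hx)
    rwa [ht₀] at h
  have hF : F = ⊤ := by
    rw [eq_top_iff]
    intro z _
    obtain ⟨a, b, -, rfl⟩ := IsFractionRing.div_surjective (A := A₀) z
    exact F.div_mem (hA₀F a.2) (hA₀F b.2)
  have hfracA : IsFractionRing A K := by
    refine IsFractionRing.of_field A K fun z => ?_
    have hz : z ∈ Subfield.closure (A : Set K) := by
      change z ∈ F
      rw [hF]
      trivial
    obtain ⟨y, hy, w, hw, rfl⟩ := Subfield.mem_closure_iff.mp hz
    have hcl : Subring.closure (A : Set K) = A.toSubring := Subring.closure_eq A.toSubring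
    rw [hcl] at hy hw
    exact ⟨⟨y, hy⟩, ⟨w, hw⟩, rfl⟩
  haveI : IsFractionRing A.toSubring K := hfracA
  -- (c) the local ring at the centre of `ν₁` is that of `A₀`
  let LA₀ : Subalgebra k K :=
    { ((Localization.subalgebra.ofField K
        ((maximalIdeal O₁).comap (Subring.inclusion hA₀)).primeCompl
        (Ideal.primeCompl_le_nonZeroDivisors _))).toSubring with
      algebraMap_mem' := fun c => le_centreLocalization O₁ A₀ hA₀ (A₀.algebraMap_mem c) }
  have hA₀LA₀ : A₀ ≤ LA₀ := fun x hx => le_centreLocalization O₁ A₀ hA₀ hx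
  have h1 : A ≤ LA₀ := hadj LA₀ (fun b _ => hgL b) (fun x _ => hNL x) (fun x _ => hDL x)
    (fun x hx => LA₀.sub_mem (LA₀.mul_mem (hA₀LA₀ (ht₀A₀ x hx)) (hDL x)) (hNL x))
  let LA : Subalgebra k K :=
    { ((Localization.subalgebra.ofField K
        ((maximalIdeal O₁).comap (Subring.inclusion hAO₁)).primeCompl
        (Ideal.primeCompl_le_nonZeroDivisors _))).toSubring with
      algebraMap_mem' := fun c => le_centreLocalization O₁ A hAO₁ (A.algebraMap_mem c) }
  have h2 : A₀ ≤ LA := by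
    have h : Algebra.adjoin k (t₀ : Set K) ≤ LA := by
      refine Algebra.adjoin_le fun x hx => ?_
      have hxt : x ∈ t₀ := Finset.mem_coe.mp hx
      have hx' := ht₀A₀ x hxt
      change x ∈ (Localization.subalgebra.ofField K
        ((maximalIdeal O₁).comap (Subring.inclusion hAO₁)).primeCompl
        (Ideal.primeCompl_le_nonZeroDivisors _))
      rw [mem_centreLocalization_iff]
      refine ⟨H x + N x, A.add_mem (hHA x hxt) (hNA x hxt), D x, hDA x hxt, hDval x hx', ?_⟩
      simp only [H]
      rw [sub_add_cancel, mul_inv_cancel_right₀ (hDne x hx')]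
    rwa [ht₀] at h
  have heq : ((Localization.subalgebra.ofField K
      ((maximalIdeal O₁).comap (Subring.inclusion hAO₁)).primeCompl
      (Ideal.primeCompl_le_nonZeroDivisors _)) : Set K)
      = (Localization.subalgebra.ofField K
      ((maximalIdeal O₁).comap (Subring.inclusion hA₀)).primeCompl
      (Ideal.primeCompl_le_nonZeroDivisors _)) :=
    le_antisymm (centreLocalization_le O₁ A A₀ hAO₁ hA₀ (fun x hx => h1 hx))
      (centreLocalization_le O₁ A₀ A hA₀ hAO₁ (fun x hx => h2 hx))
  have hregP : IsRegularLocalRing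
      (Localization.AtPrime ((maximalIdeal O₁).comap (Subring.inclusion hAO₁))) :=
    isRegularLocalRing_of_centreLocalization_eq O₁ A A₀ hAO₁ hA₀ heq hreg₀
  -- (d) the residues of `A` lie in `ι(B)`
  have hAB : ∀ x : A.toSubring, ∃ b ∈ B, residue O₁ ⟨(x : K), hO (hAO x.2)⟩ = ι b := by
    let T : Subalgebra k K :=
      { (((B.toSubring.map ι).comap (residue O₁)).map O₁.toSubring.subtype) with
        algebraMap_mem' := fun c => by
          change algebraMap k K c ∈
            (((B.toSubring.map ι).comap (residue O₁)).map O₁.toSubring.subtype)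
          rw [mem_map_subtype_comap_residue_iff]
          refine ⟨hO (hk c), ?_⟩
          rw [Subring.mem_map]
          exact ⟨algebraMap k κ c, B.algebraMap_mem c, rfl⟩ }
    have hAT : A ≤ T := by
      refine hadj T ?_ ?_ ?_ ?_
      · intro b hb
        change g b ∈ (((B.toSubring.map ι).comap (residue O₁)).map O₁.toSubring.subtype)
        rw [mem_map_subtype_comap_residue_iff]
        refine ⟨hgO₁ b, ?_⟩
        rw [Subring.mem_map, hgres b]
        exact ⟨b, htBB b hb, rfl⟩
      · intro x hx
        have hx' := ht₀A₀ x hx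
        change N x ∈ (((B.toSubring.map ι).comap (residue O₁)).map O₁.toSubring.subtype)
        rw [mem_map_subtype_comap_residue_iff]
        refine ⟨hO (hNO x), ?_⟩
        rw [Subring.mem_map, hNres x hx']
        exact ⟨_, hnd1 ⟨x, hx'⟩, rfl⟩
      · intro x hx
        have hx' := ht₀A₀ x hx
        change D x ∈ (((B.toSubring.map ι).comap (residue O₁)).map O₁.toSubring.subtype)
        rw [mem_map_subtype_comap_residue_iff]
        refine ⟨hO (hDO x), ?_⟩
        rw [Subring.mem_map, hDres x hx']
        exact ⟨_, hnd2 ⟨x, hx'⟩, rfl⟩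
      · intro x hx
        have hx' := ht₀A₀ x hx
        change H x ∈ (((B.toSubring.map ι).comap (residue O₁)).map O₁.toSubring.subtype)
        rw [mem_map_subtype_comap_residue_iff]
        refine ⟨hHO₁ x hx', ?_⟩
        rw [Subring.mem_map, hHres x hx']
        exact ⟨0, B.zero_mem, map_zero ι⟩
    intro x
    have hx := hAT x.2
    change (x : K) ∈ (((B.toSubring.map ι).comap (residue O₁)).map O₁.toSubring.subtype) at hx
    rw [mem_map_subtype_comap_residue_iff] at hx
    obtain ⟨hx₁, hx₂⟩ := hx
    rw [Subring.mem_map] at hx₂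
    obtain ⟨b, hb, hb'⟩ := hx₂
    exact ⟨b, hb, hb'.symm⟩
  -- (e) every element of `B` is a residue of `A`
  have hBA : ∀ b ∈ B, ∃ x : A.toSubring, residue O₁ ⟨(x : K), hO (hAO x.2)⟩ = ι b := by
    let ψ : A.toSubring →+* ResidueField O₁ := (residue O₁).comp (Subring.inclusion hAO₁)
    have hψ : ∀ x, ψ x = residue O₁ ⟨(x : K), hO (hAO x.2)⟩ := fun x => rfl
    let ψκ : A →ₐ[k] κ :=
      { toFun := fun x => ⟨ψ x, by obtain ⟨b, -, hb⟩ := hAB x; rw [hψ, hb]; exact b.2⟩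
        map_one' := Subtype.ext (map_one ψ)
        map_mul' := fun x y => Subtype.ext (map_mul ψ x y)
        map_zero' := Subtype.ext (map_zero ψ)
        map_add' := fun x y => Subtype.ext (map_add ψ x y)
        commutes' := fun c => Subtype.ext rfl }
    have hle : B ≤ ψκ.range := by
      rw [← htB]
      refine Algebra.adjoin_le fun b hb => ?_
      have hgb : g b ∈ A := hgA b (Finset.mem_coe.mp hb)
      refine ⟨⟨g b, hgb⟩, Subtype.ext ?_⟩
      exact hgres b
    intro b hb
    obtain ⟨x, hx⟩ := hle hb
    exact ⟨x, congrArg Subtype.val hx⟩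
  exact ⟨A, hAO, hAfg, hfracA, hregP,
    isRegularLocalRing_quotCentre_of_residues_eq O O₁ hO A hAO ι B hB hregB hAB hBA⟩

end Summit.ResolutionOfSingularities.ResolutionOfSingularities.Theorems

end
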